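/-
Copyright (c) 2026. All rights reserved.
Released under Apache 2.0 license as described in the file LICENSE.
-/
import Mathlib
import HarnessLib
import Summits.RiemannHypothesis.RiemannHypothesis.Theorems.EarlyAppointmentsCombHelpers

/-!
# Comb sum sign for CombDescentStep

This file proves that the comb sum Σ 1/(c - ξ) over real zeros has negative imaginary part
when c = x₀ + ih with h > 0.
-/

open Complex Real Set Filter Topology Metric
open scoped BigOperators Topology

noncomputable section

namespace CombSumSign

/-- For c = x₀ + ih with h > 0, each term 1/(c - ξ) with ξ real has negative imaginary part. -/
theorem inv_sub_real_im_neg {x₀ h : ℝ} (hh : 0 < h) (ξ : ℝ) :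
    (((x₀ : ℂ) + h * I - (ξ : ℂ))⁻¹).im < 0 :=
  Summit.RiemannHypothesis.RiemannHypothesis.Theorems.EarlyAppointmentsCombHelpers.im_inv_z₀_sub_real_neg x₀ h ξ hh

/-- For a finite sum over real zeros, if each term has negative Im, so does the sum.
This requires that the set is nonempty for a strict bound. -/
theorem finsum_inv_im_neg {x₀ h : ℝ} (hh : 0 < h) (S : Finset ℝ) (hS : S.Nonempty) :
    (∑ ξ ∈ S, ((x₀ : ℂ) + h * I - (ξ : ℂ))⁻¹).im < 0 := by
  have hterm : ∀ ξ ∈ S, (((x₀ : ℂ) + h * I - (ξ : ℂ))⁻¹).im < 0 :=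
    fun ξ _ => inv_sub_real_im_neg hh ξ
  -- Sum of negative terms is negative (for nonempty sum)
  -- Use that Im is ℝ-linear: (sum).im = sum of .im
  rw [Complex.im_sum]
  -- Sum of negative reals is negative when the set is nonempty
  apply Finset.sum_neg'
  · exact fun ξ hξ => le_of_lt (hterm ξ hξ)
  · obtain ⟨ξ₀, hξ₀⟩ := hS
    exact ⟨ξ₀, hξ₀, hterm ξ₀ hξ₀⟩

/-- Bound on imaginary part: |Im(1/(c - ξ))| ≤ 1/h. -/
theorem abs_inv_sub_real_im_le {x₀ h : ℝ} (hh : 0 < h) (ξ : ℝ) :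
    |((( x₀ : ℂ) + h * I - (ξ : ℂ))⁻¹).im| ≤ 1 / h :=
  Summit.RiemannHypothesis.RiemannHypothesis.Theorems.EarlyAppointmentsCombHelpers.abs_im_inv_z₀_sub_real_le x₀ h ξ hh

end CombSumSign

end
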